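import Literature.IUT.HodgeArakelov.ThetaGauLinks
import Literature.IUT.HodgeTheaters.Processions
import Literature.IUT.HodgeTheaters.PMBaseProcessions

/-!
# [IUTchII] Corollary 4.11 (i), (iii): compatibility of the étale-picture of `D-Θ^{±ell}NF`-Hodge theaters
# with [IUTchI] Corollaries 4.12, 6.10 — PROOF-ONLY companion of `ThetaGauLinks.lean`

S. Mochizuki, *Inter-universal Teichmüller theory II*, §4, Corollary 4.11 (i)–(iii) (kurims Dec-2020
manuscript pp. 163–164) [cite: Mochizuki2012, Cor 4.11 p.163]. Claim key DISPUTED (D-0012); nothing here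
asserts a disputed claim or takes a side on [IUTchIII] Cor 3.12. DAG node ids: `IUTchII:Cor4.11(i)`,
`IUTchII:Cor4.11(iii)` (D-0067 cone interior, plan/CONE-BOARD.tsv); no new definition, no new `Prop` slot.

**What is printed (p. 164).** (i) "this infinite chain induces a chain of full poly-isomorphisms
`… ⥲ ⁿD^⊢_△ ⥲ ⁽ⁿ⁺¹⁾D^⊢_△ ⥲ …` [cf. Corollary 4.10, (iv)]. That is to say, "`(−)D^⊢_△`" forms a constant
invariant … — i.e., a mono-analytic core". (iii) "The constructions of (i) and (ii) are compatible, in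
the evident sense, with the constructions of [IUTchI], Corollaries 4.12, 6.10, relative to the natural
identification isomorphisms `(−)D^⊢_△ ⥲ (−)D^⊢_>` [cf. Corollary 4.10, (i); the discussion preceding
[IUTchI], Example 5.4] and the operation of passing to the underlying `D`-ΘNF- [in the case of [IUTchI],
Corollary 4.12] and `D`-Θ^{±ell}-Hodge theaters [in the case of [IUTchI], Corollary 6.10]." Printed proof:
"follow immediately from the definitions and the references quoted".

**What was missing.** `ThetaGauLinks.lean` (abc-iut-L6-t2/t6, p404606) typed Cor 4.10/4.11 over the
interface `ThetaLinkSetting FV FVM FUM DM` (four category parameters) and left (iii) without a kernel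
("no statable kernel until … the [IUTchI] étale-pictures (abc-iut-L5-t3/t4) are real"). The [IUTchI]
étale-pictures are now BUILT: `DThetaNFChain`, `DThetaNFLink`, `DEtalePicture` (Cor 4.12, abc-iut-L5-t3,
`Processions.lean` p407106) over `BaseThetaDatum`, and `DThetaPMEllHT.dLink` / `EtalePicture` (Cor 6.10,
abc-iut-L5-t4, `PMBaseProcessions.lean` p408359) over `PMBaseKit.MultKit`.

**What is proved here (theorems only), in the idiom of abc-iut-L5-t4's rendering of [IUTchI] Cor 6.10 (iv)
(`DThetaPMEllHT.CoreCompat`: "compatible … in the evident sense" = agreement of the mono-analytic cores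
relative to a given comparison).** Instantiate the `D^⊢`-prime-strip category `DM` of the [IUTchII] setting
with the REAL category of `D^⊢`-prime-strips of [IUTchI] §4 (`𝔡.DMonoPrimeStrip`) resp. §6 (`M.DMono`); the
"natural identification isomorphisms `(−)D^⊢_△ ⥲ (−)D^⊢_>`" and "the underlying `D`-ΘNF- / `D`-Θ^{±ell}-Hodge
theaters" of the chain are the PARAMETERS `ι`, `C` (exactly the printed comparison data; no `Prop` slot):
* (i) over the [IUTchI] §4 category: composites of the `D`-`Θ^{±ell}NF`-links along the chain stay FULL
  (`ThetaGauChain.cor411i_dLink_comp`) — the "constant invariant / mono-analytic core" sentence, which over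
  the bare interface `DM` needs an isomorphism between the cores that `ThetaGauLinks` could not supply;
* (iii)/Cor 4.12: conjugating the `D`-`Θ^{±ell}NF`-link `ⁿD^⊢_△ ⥲ ᵐD^⊢_△` by the identification isomorphisms
  IS the `D`-ΘNF-link `ⁿD^⊢_> ⥲ ᵐD^⊢_>` of [IUTchI] Cor 4.12 (i)/(ii) (`HodgeTheaterStrips.cor411iii_dLink_conj`,
  chain form `ThetaGauChain.cor411iii_link_conj`), the core of the [IUTchI] étale-picture of the underlying
  chain is identified with `⁰D^⊢_△` (`ThetaGauChain.cor411iii_core`), and the permutation symmetries of the two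
  étale-pictures act by the SAME permutation of the common spoke labels `ℤ`, both fixing the core
  (`ThetaGauChain.cor411iii_spokePerm_compat`);
* (iii)/Cor 6.10: the same over abc-iut-L5-t4's groupoid `M.DMono`, where the [IUTchI] link is the set of
  ALL morphisms: the identification carries the `D`-`Θ^{±ell}NF`-link onto `DThetaPMEllHT.dLink`
  (`HodgeTheaterStrips.cor411iii_dLink_conj_hom`, `ThetaGauChain.cor411iii_link610_conj`), and the spoke
  permutations agree (`ThetaGauChain.cor411iii_spokePerm610_compat`).
Deliberately NOT here: Cor 4.10 (v) / the `ℝ_{>0}`-orbit clause (abc-iut-L6-t2 `GlobalGaussianFrobenioids`),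
any statement at the level of `Θ^{±ell}NF`-Hodge theaters themselves ([IUTchI] Def 6.13 container of
abc-iut-L5-t4/t5 is in review — the compatibility is therefore phrased, as print phrases it, relative to the
GIVEN underlying chains and identification isomorphisms).
-/

namespace Literature.IUT.HodgeArakelov

open CategoryTheory
open Literature.IUT.HodgeTheaters
open Literature.IUT.LogThetaLattice

universe v₁ v₂ v₃ u₁ u₂ u₃ u

/-! ### 1. Cor 4.11 (i), (iii) against [IUTchI] Cor 4.12 (`D`-ΘNF-Hodge theaters, abc-iut-L5-t3) -/

section Cor412

variable {FV : Type u₁} [Category.{v₁} FV] {FVM : Type u₂} [Category.{v₂} FVM]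
  {FUM : Type u₃} [Category.{v₃} FUM] {𝔡 : BaseThetaDatum.{u}}
  {S : ThetaLinkSetting FV FVM FUM 𝔡.DMonoPrimeStrip}

/-- **Cor 4.11 (iii) vs [IUTchI] Cor 4.12 (i)**, one link: for `Θ^{±ell}NF`-Hodge theaters `†HT`, `‡HT`
(through their strips `dag`, `ddag`) with underlying `D`-ΘNF-Hodge theaters `H`, `H'` and natural
identification isomorphisms `ι : †D^⊢_△ ⥲ †D^⊢_>`, `ι' : ‡D^⊢_△ ⥲ ‡D^⊢_>` [Cor 4.10 (i)], conjugating the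
`D`-`Θ^{±ell}NF`-link `†D^⊢_△ ⥲ ‡D^⊢_△` [Cor 4.10 (iv)] by `ι`, `ι'` yields EXACTLY the `D`-ΘNF-link
`†D^⊢_> ⥲ ‡D^⊢_>` of [IUTchI] Cor 4.12 (i) (both are the full poly-isomorphism).
[cite: Mochizuki2012, Cor 4.11 (iii) p.164] -/
theorem HodgeTheaterStrips.cor411iii_dLink_conj (dag ddag : HodgeTheaterStrips S)
    (H H' : 𝔡.DThetaNFHodgeTheater)
    (ι : S.toDMono.obj (S.toUnitMu.obj (S.toVdashMu.obj dag.delta)) ≅ H.monoCod)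
    (ι' : S.toDMono.obj (S.toUnitMu.obj (S.toVdashMu.obj ddag.delta)) ≅ H'.monoCod) :
    polyIsoConj ι.symm (dag.dLink ddag) ι' = BaseThetaDatum.DThetaNFLink 𝔡 H H' := by
  unfold HodgeTheaterStrips.dLink BaseThetaDatum.DThetaNFLink
  exact polyIsoConj_full _ _

/-- **Cor 4.11 (iii) vs [IUTchI] Cor 4.12 (i)**, converse transport: conjugating the `D`-ΘNF-link of
[IUTchI] Cor 4.12 (i) back along the identification isomorphisms yields the `D`-`Θ^{±ell}NF`-link of
Cor 4.10 (iv) / 4.11 (i). [cite: Mochizuki2012, Cor 4.11 (iii) p.164] -/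
theorem HodgeTheaterStrips.cor411iii_dThetaNFLink_conj (dag ddag : HodgeTheaterStrips S)
    (H H' : 𝔡.DThetaNFHodgeTheater)
    (ι : S.toDMono.obj (S.toUnitMu.obj (S.toVdashMu.obj dag.delta)) ≅ H.monoCod)
    (ι' : S.toDMono.obj (S.toUnitMu.obj (S.toVdashMu.obj ddag.delta)) ≅ H'.monoCod) :
    polyIsoConj ι (BaseThetaDatum.DThetaNFLink 𝔡 H H') ι'.symm = dag.dLink ddag := by
  unfold HodgeTheaterStrips.dLink BaseThetaDatum.DThetaNFLink
  exact polyIsoConj_full _ _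

variable (P : ThetaGauChain S)

/-- **Cor 4.11 (i)** ("`(−)D^⊢_△` forms a constant invariant — i.e., a mono-analytic core — of the above
infinite chain"), over the [IUTchI] §4 category of `D^⊢`-prime-strips: the composite of the
`D`-`Θ^{±ell}NF`-links `ⁿD^⊢_△ ⥲ ᵐD^⊢_△ ⥲ ᵏD^⊢_△` is again the (full) link `ⁿD^⊢_△ ⥲ ᵏD^⊢_△`. (Over the bare
interface `DM` of `ThetaGauLinks` this needs an isomorphism `ⁿD^⊢_△ ≅ ᵐD^⊢_△`, supplied here by
`BaseThetaDatum.DMonoPrimeStrip.nonempty_iso`: all `D^⊢`-prime-strips are isomorphic.)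
[cite: Mochizuki2012, Cor 4.11 (i) p.164] -/
theorem ThetaGauChain.cor411i_dLink_comp (n m k : ℤ) :
    PolyIso.comp ((P.theater n).dLink (P.theater m)) ((P.theater m).dLink (P.theater k)) =
      (P.theater n).dLink (P.theater k) := by
  unfold HodgeTheaterStrips.dLink
  exact full_comp_full (BaseThetaDatum.DMonoPrimeStrip.nonempty_iso _ _).some

/-- **Cor 4.11 (i)**: in particular every `D`-`Θ^{±ell}NF`-link of the chain, and every composite of
consecutive links, is nonempty (the core is well defined up to these full poly-isomorphisms).
[cite: Mochizuki2012, Cor 4.11 (i) p.164] -/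
theorem ThetaGauChain.cor411i_dLink_nonempty (n m : ℤ) :
    ((P.theater n).dLink (P.theater m)).Nonempty :=
  ⟨(BaseThetaDatum.DMonoPrimeStrip.nonempty_iso _ _).some, Set.mem_univ _⟩

variable (C : 𝔡.DThetaNFChain)
  (ι : ∀ n : ℤ,
    S.toDMono.obj (S.toUnitMu.obj (S.toVdashMu.obj (P.theater n).delta)) ≅ (C.HT n).monoCod)

/-- **Cor 4.11 (iii) vs [IUTchI] Cor 4.12 (ii)**, chain form: for an infinite chain of `Θ^{±ell}NF`-Hodge
theaters [Cor 4.10 (vi)] with underlying chain `C` of `D`-ΘNF-Hodge theaters and identification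
isomorphisms `ιₙ : ⁿD^⊢_△ ⥲ ⁿD^⊢_>`, the `n`-th link of the chain of full poly-isomorphisms of Cor 4.11 (i),
conjugated by `ιₙ`, `ιₙ₊₁`, is the `n`-th link `ⁿD^⊢_> ⥲ ⁽ⁿ⁺¹⁾D^⊢_>` of [IUTchI] Cor 4.12 (ii).
[cite: Mochizuki2012, Cor 4.11 (iii) p.164] -/
theorem ThetaGauChain.cor411iii_link_conj (n : ℤ) :
    polyIsoConj (ι n).symm ((P.theater n).dLink (P.theater (n + 1))) (ι (n + 1)) = C.link n :=
  (P.theater n).cor411iii_dLink_conj (P.theater (n + 1)) _ _ (ι n) (ι (n + 1))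

/-- **Cor 4.11 (iii) vs [IUTchI] Cor 4.12 (ii)/(iii)**, the cores: the identification `ι₀` identifies the
[IUTchII] core `⁰D^⊢_△` with the core `>^⊢ = ⁰D^⊢_>` of the étale-picture of [IUTchI] Cor 4.12 (iii) of the
underlying chain, and for every spoke `n` the conjugated link `ⁿD^⊢_△ ⥲ ⁰D^⊢_△ ⥲ >^⊢` is the attaching
(full) poly-isomorphism `ⁿD^⊢_> ⥲ >^⊢` of that étale-picture. [cite: Mochizuki2012, Cor 4.11 (iii) p.164] -/
theorem ThetaGauChain.cor411iii_core (n : ℤ) :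
    C.etalePicture.core = (C.HT 0).monoCod ∧ C.etalePicture.spoke n = C.HT n ∧
      polyIsoConj (ι n).symm ((P.theater n).dLink (P.theater 0)) (ι 0) = C.etalePicture.attach n := by
  refine ⟨rfl, rfl, ?_⟩
  unfold HodgeTheaterStrips.dLink BaseThetaDatum.DEtalePicture.attach
  exact polyIsoConj_full _ _

/-- **Cor 4.11 (ii)/(iii) vs [IUTchI] Cor 4.12 (iii)**, permutation symmetries: the "arbitrary
permutation symmetries among the spokes [i.e., the labels `n ∈ ℤ`]" of the two étale-pictures are
compatible — a permutation `σ` of `ℤ` acts on the [IUTchII] étale-picture (the star graph of abc-iut-L6-t3,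
`cor411ii_spokePerm`) by `•ₙ ↦ •_{σ n}` fixing the core, and on the [IUTchI] étale-picture of the underlying
chain (`DEtalePicture.perm`) by relabelling the spokes `ⁿHT ↦ ^{σ n}HT` with the same core and the same
attaching poly-isomorphisms. [cite: Mochizuki2012, Cor 4.11 (iii) p.164] -/
theorem ThetaGauChain.cor411iii_spokePerm_compat (σ : Equiv.Perm ℤ) (n : ℤ) :
    cor411ii_spokePerm σ (some n) = some (σ n) ∧ (C.etalePicture.perm σ).spoke n = C.etalePicture.spoke (σ n) ∧
      cor411ii_spokePerm σ none = none ∧ (C.etalePicture.perm σ).core = C.etalePicture.core ∧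
      (C.etalePicture.perm σ).attach n = C.etalePicture.attach (σ n) :=
  ⟨rfl, ((C.etalePicture.perm_spec σ).2.1 n), rfl, (C.etalePicture.perm_spec σ).1,
    ((C.etalePicture.perm_spec σ).2.2.1 n).1⟩

end Cor412

/-! ### 2. Cor 4.11 (i), (iii) against [IUTchI] Cor 6.10 (`D`-Θ^{±ell}-Hodge theaters, abc-iut-L5-t4) -/

section Cor610

variable {FV : Type u₁} [Category.{v₁} FV] {FVM : Type u₂} [Category.{v₂} FVM]
  {FUM : Type u₃} [Category.{v₃} FUM] {l : ℕ} {K : PMBaseKit.{u} l} {M : K.MultKit}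
  {S : ThetaLinkSetting FV FVM FUM M.DMono}

/-- **Cor 4.11 (iii) vs [IUTchI] Cor 6.10 (i)**, one link: with underlying `D`-Θ^{±ell}-Hodge theaters
`H`, `H'` and identification isomorphisms `ι : †D^⊢_△ ⥲ †𝔇^⊢_>`, `ι' : ‡D^⊢_△ ⥲ ‡𝔇^⊢_>`, the
`D`-`Θ^{±ell}NF`-link `†D^⊢_△ ⥲ ‡D^⊢_△` conjugated by `ι`, `ι'` is carried onto the `D`-Θ^{±ell}-link
`†𝔇^⊢_> ⥲ ‡𝔇^⊢_>` of [IUTchI] Cor 6.10 (i) (abc-iut-L5-t4 records the latter as the set of ALL morphisms of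
the groupoid `M.DMono`; every morphism of a groupoid underlies an isomorphism).
[cite: Mochizuki2012, Cor 4.11 (iii) p.164] -/
theorem HodgeTheaterStrips.cor411iii_dLink_conj_hom (dag ddag : HodgeTheaterStrips S)
    (H H' : K.DThetaPMEllHT)
    (ι : S.toDMono.obj (S.toUnitMu.obj (S.toVdashMu.obj dag.delta)) ≅ PMBaseKit.DThetaPMEllHT.monoCore M H)
    (ι' : S.toDMono.obj (S.toUnitMu.obj (S.toVdashMu.obj ddag.delta)) ≅
      PMBaseKit.DThetaPMEllHT.monoCore M H') :
    (fun e => e.hom) '' polyIsoConj ι.symm (dag.dLink ddag) ι' = PMBaseKit.DThetaPMEllHT.dLink M H H' := by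
  unfold HodgeTheaterStrips.dLink PMBaseKit.DThetaPMEllHT.dLink
  rw [polyIsoConj_full]
  ext h
  simp only [PolyIso.full, Set.image_univ, Set.mem_range, Set.mem_univ, iff_true]
  exact ⟨Groupoid.isoEquivHom _ _ |>.symm h, rfl⟩

variable (P : ThetaGauChain S) (C : ℤ → K.DThetaPMEllHT)
  (ι : ∀ n : ℤ, S.toDMono.obj (S.toUnitMu.obj (S.toVdashMu.obj (P.theater n).delta)) ≅
    PMBaseKit.DThetaPMEllHT.monoCore M (C n))

/-- **Cor 4.11 (iii) vs [IUTchI] Cor 6.10 (ii)**, chain form: the `n`-th link of the chain of Cor 4.11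
(i), conjugated by the identification isomorphisms, is carried onto the `n`-th `D`-Θ^{±ell}-link of the
underlying chain `C` of `D`-Θ^{±ell}-Hodge theaters; and the links of `C` compose to links (abc-iut-L5-t4's
`chain_constant_invariant`, the [IUTchI] mono-analytic core). [cite: Mochizuki2012, Cor 4.11 (iii) p.164] -/
theorem ThetaGauChain.cor411iii_link610_conj (n : ℤ) :
    (fun e => e.hom) '' polyIsoConj (ι n).symm ((P.theater n).dLink (P.theater (n + 1))) (ι (n + 1)) =
        PMBaseKit.DThetaPMEllHT.dLink M (C n) (C (n + 1)) ∧
      {h | ∃ f ∈ PMBaseKit.DThetaPMEllHT.dLink M (C n) (C (n + 1)),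
          ∃ g ∈ PMBaseKit.DThetaPMEllHT.dLink M (C (n + 1)) (C (n + 2)), h = f ≫ g} =
        PMBaseKit.DThetaPMEllHT.dLink M (C n) (C (n + 2)) :=
  ⟨(P.theater n).cor411iii_dLink_conj_hom (P.theater (n + 1)) _ _ (ι n) (ι (n + 1)),
    PMBaseKit.DThetaPMEllHT.chain_constant_invariant M C n (n + 1) (n + 2)⟩

/-- **Cor 4.11 (ii)/(iii) vs [IUTchI] Cor 6.10 (iii)**, permutation symmetries: for an étale-picture `E`
of `D`-Θ^{±ell}-Hodge theaters whose spokes are the underlying chain `C`, a permutation `σ` of the spoke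
labels `ℤ` acts compatibly on the [IUTchII] étale-picture (`cor411ii_spokePerm`, fixing the core) and on `E`
(abc-iut-L5-t4's `EtalePicture.permute`: spokes relabelled by `σ`, same core, same attaching
poly-morphisms). [cite: Mochizuki2012, Cor 4.11 (iii) p.164] -/
theorem ThetaGauChain.cor411iii_spokePerm610_compat (E : PMBaseKit.DThetaPMEllHT.EtalePicture M ℤ)
    (hE : E.spoke = C) (σ : Equiv.Perm ℤ) (n : ℤ) :
    cor411ii_spokePerm σ (some n) = some (σ n) ∧ (E.permute M σ).spoke n = C (σ n) ∧
      cor411ii_spokePerm σ none = none ∧ (E.permute M σ).core = E.core ∧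
      (E.permute M σ).attach n = E.attach (σ n) := by
  subst hE
  exact ⟨rfl, rfl, rfl, rfl, rfl⟩

end Cor610

end Literature.IUT.HodgeArakelov
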